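import Literature.Analysis.FluidPDE.VorticityCalculus
import Literature.Analysis.FluidPDE.VectorCalculusProofs
import Literature.Analysis.FluidPDE.DistributionalToWeak
import Literature.MeasureTheory.Lebesgue.VitaliSet
import HarnessLib

/-!
# "Dropping the pressure" fails for non-measurable data: a counterexample on `ℝ³`

Analysis/FluidPDE. The named fact formerly vendored as
`Literature.Analysis.FluidPDE.IsDistributionalNSSolutionOn.isWeakNSSolutionOn_of`
(`Literature/Analysis/FluidPDE/WeakSolution.lean`, cited to Caffarelli–Kohn–Nirenberg 1982, §2:
"dropping the pressure" — a distributional solution on the slab `(0,T) × E`, locally square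
integrable up to `t = 0` and attaining the datum `u₀` in `L²_loc`, is a weak solution with datum
`u₀`; retired from `WeakSolution.lean` in the 2026-08-15 verdict clean-up, this file being its
refutation) quantified over an ARBITRARY datum `u₀ : E → E`, constrained only through the *lower*
Lebesgue integrals `∫⁻ x in K, ‖u t x - u₀ x‖ₑ ^ 2` of its hypothesis `h₀`, while its conclusion
contains the *Bochner* integral `∫ ⟪u₀, ψ 0⟫`. This file proves, sorry-free, that that statement —
written out in full in `IsDistributionalNSSolutionOn.not_forall_isWeakNSSolutionOn_of` below, so
that the refutation is self-contained and survives the retirement of the def — is false (on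
`E = ℝ³ = EuclideanSpace ℝ (Fin 3)` with `T = 1`, `ν = 0`, `p = 0`). The corrected fact (one extra
hypothesis, `AEStronglyMeasurable u₀ volume`, which every printed source has implicitly: the datum
is an `L²_loc` field, Robinson–Rodrigo–Sadowski 2016, Def. 3.3; Lemarié-Rieusset 2016, Def. 6.2)
is PROVED in `Literature/Analysis/FluidPDE/DistributionalToWeak.lean`
(`IsDistributionalNSSolutionOn.isWeakNSSolutionOn_of_aestronglyMeasurable_holds`).

## The counterexample (`namespace Literature.Fluid.DistributionalToWeakCounterexample`)

* `θ := curl (η • e₂)` with `η` a smooth bump (`ContDiffBump`, `1` on `B̄(0,1)`, `0` off `B(0,2)`):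
  a smooth, compactly supported, divergence-free (`divergence_curl_eq_zero_holds`) field with
  `θ ≢ 0` (`exists_θ_ne_zero`: its second component is `-∂₀η`, and `η` is not constant along
  `ℝ e₀`).
* `u(t) := θ`, `p := 0`, `ν := 0`, `f := (θ·∇)θ`: a stationary distributional Euler solution on
  every open `Q ⊆ ℝ × E` (`isDistributionalNSSolutionOn_stationary_of_isDivFree`, proved for any
  smooth compactly supported divergence-free `θ` on any `E`: `∫∫ ⟪θ, ∂ₜψ⟫ = 0` by integrating
  first in time, and `⟪θ, (θ·∇)ψ⟫ + ⟪(θ·∇)θ, ψ⟫ = ⟪θ, ∇⟪θ, ψ(t)⟫⟫` integrates to zero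
  slice-wise because `θ` is weakly divergence free, `IsDivFree.isWeaklyDivFree_holds`); the
  hypotheses `hu`, `hf` hold since `θ`, `(θ·∇)θ` are bounded and continuous.
* the datum `u₀ := θ + 𝟙_A w` with `w := θ(x₀) ≠ 0` and `A` the Vitali slab of
  `Literature/MeasureTheory/Lebesgue/VitaliSet.lean` around `x₀`
  (`Literature.MeasureTheory.Lebesgue.Vitali.exists_innerNull_not_nullMeasurableSet`: every measurable subset of `A` is null,
  and `A ∩ U` is not null-measurable for the open set `U = {⟪w, θ⟫ ≠ 0} ∋ x₀`). Then `h₀` holds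
  trivially: `∫⁻_K ‖u(t) - u₀‖ₑ² = ∫⁻_K ‖𝟙_A w‖ₑ² = 0` for every `t`
  (`lintegral_indicator_datum_eq_zero` of `DistributionalToWeak`).
* the conclusion `IsWeakNSSolutionOn 1 0 f u₀ u` fails for the divergence-free test field
  `ψ(t, x) := χ(t) θ(x)` (`χ` a bump in time, `χ(0) = 1`, `supp χ = [-1/2, 1/2] ⊆ (-∞, 1)`): the
  space–time part of the weak identity is `∫₀¹ χ' · ‖θ‖²_{L²} + 2∫₀¹ χ · ∫ ⟪(θ·∇)θ, θ⟫ = -‖θ‖²_{L²}`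
  (`integral_inner_convect_self_eq_zero_holds`, fundamental theorem of calculus), while the datum
  term `∫ ⟪u₀, ψ 0⟫ = ∫ ⟪θ + 𝟙_A w, θ⟫` is the Bochner integral of a function which is not
  a.e.-strongly measurable (its difference with the continuous `‖θ‖²` is `𝟙_A ⟪w, θ⟫`, whose
  support `A ∩ U` is not null-measurable), hence `0` by Mathlib's convention
  (`integral_non_aestronglyMeasurable`); and `-‖θ‖²_{L²} + 0 ≠ 0`.

## References

* L. Caffarelli, R. Kohn, L. Nirenberg, *Partial regularity of suitable weak solutions of the
  Navier–Stokes equations*, Comm. Pure Appl. Math. 35 (1982), §2 (the cited source of the fact;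
  not held, acq-00031).
* J. C. Robinson, J. L. Rodrigo, W. Sadowski, *The Three-Dimensional Navier–Stokes Equations*,
  CUP 2016, Def. 3.3 (datum `u₀ ∈ H`).
* R. L. Wheeden, A. Zygmund, *Measure and Integral* (1977), Thm. (3.38)–Cor. (3.39) (Vitali set).
-/

noncomputable section

open MeasureTheory TopologicalSpace Set Function Filter Topology InnerProductSpace Metric
open scoped RealInnerProductSpace ENNReal NNReal Laplacian ContDiff

namespace Literature.Analysis.FluidPDE

/-! ### Test fields: vanishing off the support, joint continuity of slice derivatives -/

section TestField

variable {X : Type*} [NormedAddCommGroup X] [NormedSpace ℝ X]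
variable {F : Type*} [NormedAddCommGroup F] [NormedSpace ℝ F]

omit [NormedSpace ℝ X] in
/-- Off the support of the uncurried field, the time derivative of `ψ` vanishes. [folklore] -/
theorem timeDeriv_eq_zero_of_notMem_tsupport {ψ : ℝ → X → F} {t : ℝ} {x : X}
    (h : (t, x) ∉ tsupport (uncurry ψ)) : timeDeriv ψ t x = 0 := by
  have h0 : uncurry ψ =ᶠ[𝓝 (t, x)] 0 := notMem_tsupport_iff_eventuallyEq.1 h
  have hc : Continuous fun s : ℝ => (s, x) := continuous_id.prodMk continuous_const
  have h1 : (fun s => ψ s x) =ᶠ[𝓝 t] fun _ => (0 : F) := (hc.tendsto t).eventually h0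
  rw [timeDeriv_apply, h1.deriv_eq, deriv_const]

/-- Off the support of the uncurried field, the slices of `ψ` have vanishing derivative. [folklore] -/
theorem fderiv_slice_eq_zero_of_notMem_tsupport {ψ : ℝ → X → F} {t : ℝ} {x : X}
    (h : (t, x) ∉ tsupport (uncurry ψ)) : fderiv ℝ (ψ t) x = 0 := by
  have h0 : uncurry ψ =ᶠ[𝓝 (t, x)] 0 := notMem_tsupport_iff_eventuallyEq.1 h
  have hc : Continuous fun y : X => (t, y) := continuous_const.prodMk continuous_id
  have h1 : ψ t =ᶠ[𝓝 x] fun _ => (0 : F) := (hc.tendsto x).eventually h0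
  rw [h1.fderiv_eq, fderiv_fun_const, Pi.zero_apply]

omit [NormedSpace ℝ X] [NormedSpace ℝ F] in
/-- Off the support of the uncurried field, `ψ t x = 0`. [folklore] -/
theorem apply_eq_zero_of_notMem_tsupport {ψ : ℝ → X → F} {t : ℝ} {x : X}
    (h : (t, x) ∉ tsupport (uncurry ψ)) : ψ t x = 0 :=
  show uncurry ψ (t, x) = 0 from image_eq_zero_of_notMem_tsupport h

omit [NormedSpace ℝ X] [NormedSpace ℝ F] in
/-- The time lines `s ↦ ψ s x` of a compactly supported space–time field have compact support. [folklore] -/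
theorem hasCompactSupport_line {ψ : ℝ → X → F} (hψ : HasCompactSupport (uncurry ψ)) (x : X) :
    HasCompactSupport fun s => ψ s x :=
  HasCompactSupport.intro (hψ.image continuous_fst) fun s hs =>
    apply_eq_zero_of_notMem_tsupport fun h => hs ⟨(s, x), h, rfl⟩

end TestField

section TestFieldGradient

variable {E : Type*} [NormedAddCommGroup E] [InnerProductSpace ℝ E] [FiniteDimensional ℝ E]
variable {F' : Type*} [NormedAddCommGroup F'] [InnerProductSpace ℝ F']

/-- Off the support of the uncurried field, the slices of a scalar field have vanishing gradient. [folklore] -/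
theorem gradient_slice_eq_zero_of_notMem_tsupport {Θ : ℝ → E → ℝ} {t : ℝ} {x : E}
    (h : (t, x) ∉ tsupport (uncurry Θ)) : gradient (Θ t) x = 0 := by
  haveI : CompleteSpace E := FiniteDimensional.complete ℝ E
  rw [gradient, fderiv_slice_eq_zero_of_notMem_tsupport h, map_zero]

omit [FiniteDimensional ℝ E] in
/-- Joint continuity of `(t, x) ↦ ((θ·∇)ψ(t,·))(x) = D(ψ t)(x)[θ x]` for a test field `ψ` and a
smooth field `θ`. [folklore] -/
theorem IsSpaceTimeTestOn.continuous_convect_slice {Q : Opens (ℝ × E)} {ψ : ℝ → E → F'}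
    (hψ : IsSpaceTimeTestOn Q ψ) {θ : E → E} (hθ : ContDiff ℝ ∞ θ) :
    Continuous fun z : ℝ × E => convect θ (ψ z.1) z.2 := by
  have hθ' : IsSmoothSpaceTimeOn univ (fun _ : ℝ => θ) :=
    (hθ.comp contDiff_snd).contDiffOn
  have h := (hθ'.convect (hψ.isSmoothSpaceTimeOn univ) uniqueDiffOn_univ).continuousOn
  rw [univ_prod_univ, continuousOn_univ] at h
  exact h

/-- Joint continuity of `(t, x) ↦ ∇(Θ t)(x)` for a scalar test field `Θ`. [folklore] -/
theorem IsSpaceTimeTestOn.continuous_gradient_slice {Q : Opens (ℝ × E)} {Θ : ℝ → E → ℝ}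
    (hΘ : IsSpaceTimeTestOn Q Θ) : Continuous fun z : ℝ × E => gradient (Θ z.1) z.2 := by
  have h := ((hΘ.isSmoothSpaceTimeOn univ).gradient uniqueDiffOn_univ).continuousOn
  rw [univ_prod_univ, continuousOn_univ] at h
  exact h

end TestFieldGradient

/-! ### Stationary smooth divergence-free fields are distributional Euler solutions -/

section Stationary

variable {E : Type*} [NormedAddCommGroup E] [InnerProductSpace ℝ E] [FiniteDimensional ℝ E]
  [MeasurableSpace E] [BorelSpace E]

/-- **A smooth, compactly supported, divergence-free field is a stationary distributional Euler
solution for the force it generates.** For `θ ∈ C_c^∞(E; E)` with `div θ = 0`, the stationary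
velocity `u(t, x) = θ(x)` with pressure `p = 0`, viscosity `ν = 0` and force `f = (θ·∇)θ` is a
distributional solution on every open `Q ⊆ ℝ × E`: local integrability is that of continuous
functions; `∫∫_Q ⟪θ, ∇ₓΘ⟫ = ∫ dt ∫ ⟪θ, ∇Θ(t,·)⟫ dx = 0` slice-wise (`div θ = 0`, Gauss–Green);
`∫∫_Q ⟪θ, ∂ₜψ⟫ = ∫ dx ⟪θ(x), ∫ ∂ₜψ(·,x) dt⟫ = 0` (compact support in time); and
`⟪θ, (θ·∇)ψ⟫ + ⟪(θ·∇)θ, ψ⟫ = (θ·∇)⟪θ, ψ⟫ = ⟪θ, ∇⟪θ, ψ(t,·)⟫⟫` integrates to `0` in `x` for every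
`t`, again because `θ` is (weakly) divergence free. [folklore] -/
theorem isDistributionalNSSolutionOn_stationary_of_isDivFree {θ : E → E}
    (hθ : FunctionSpaces.IsTestFunctionOn (⊤ : Opens E) θ) (hdiv : VectorCalculus.IsDivFree θ) (Q : Opens (ℝ × E)) :
    IsDistributionalNSSolutionOn Q 0 (fun _ => convect θ θ) (fun _ => θ) 0 := by
  haveI : CompleteSpace E := FiniteDimensional.complete ℝ E
  have hθ1 : ContDiff ℝ 1 θ := hθ.contDiff.of_le (by exact_mod_cast le_top)
  have hθc : Continuous θ := hθ.contDiff.continuous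
  have hθd : Differentiable ℝ θ := hθ1.differentiable one_ne_zero
  have hDθc : Continuous (fderiv ℝ θ) := hθ1.continuous_fderiv one_ne_zero
  have hconv : Continuous (convect θ θ) := by
    show Continuous fun x => fderiv ℝ θ x (θ x)
    exact hDθc.clm_apply hθc
  have hwdf : IsWeaklyDivFree θ := VectorCalculus.IsDivFree.isWeaklyDivFree_holds hdiv hθ1
  have hQm : MeasurableSet (Q : Set (ℝ × E)) := Q.isOpen.measurableSet
  refine ⟨?_, ?_, ?_, ?_, ?_⟩
  · exact ((hθc.comp continuous_snd).continuousOn).locallyIntegrableOn hQm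
  · exact (((hθc.comp continuous_snd).norm.pow 2).continuousOn).locallyIntegrableOn hQm
  · exact (continuous_const (y := (0 : ℝ))).continuousOn.locallyIntegrableOn hQm
  · -- weak divergence-freeness, slice by slice
    intro Θ hΘ
    set F : ℝ × E → ℝ := fun z => ⟪θ z.2, gradient (Θ z.1) z.2⟫ with hF
    have hFc : Continuous F := (hθc.comp continuous_snd).inner hΘ.continuous_gradient_slice
    have hF0 : ∀ z ∉ tsupport (uncurry Θ), F z = 0 := fun z hz => by
      simp only [hF, gradient_slice_eq_zero_of_notMem_tsupport (t := z.1) (x := z.2) hz,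
        inner_zero_right]
    have hFcs : HasCompactSupport F := HasCompactSupport.intro hΘ.hasCompactSupport hF0
    have hFi : Integrable F ((volume : Measure ℝ).prod (volume : Measure E)) := by
      rw [← Measure.volume_eq_prod]; exact hFc.integrable_of_hasCompactSupport hFcs
    have hslice : ∀ t, ∫ x, F (t, x) = 0 := fun t =>
      hwdf (Θ t) ⟨hΘ.contDiff_slice t, hΘ.hasCompactSupport_slice t, by simp⟩
    calc ∫ z in (Q : Set (ℝ × E)), F z = ∫ z, F z :=
          setIntegral_eq_integral_of_forall_compl_eq_zero fun z hz =>
            hF0 z fun h => hz (hΘ.tsupport_subset h)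
      _ = ∫ t, ∫ x, F (t, x) := by rw [Measure.volume_eq_prod, integral_prod F hFi]
      _ = 0 := by simp [hslice]
  · -- the momentum identity
    intro ψ hψ
    set G₁ : ℝ × E → ℝ := fun z => ⟪θ z.2, timeDeriv ψ z.1 z.2⟫ with hG₁
    set G₂ : ℝ × E → ℝ := fun z =>
      ⟪θ z.2, convect θ (ψ z.1) z.2⟫ + ⟪convect θ θ z.2, ψ z.1 z.2⟫ with hG₂
    have hψc : Continuous (uncurry ψ) := hψ.contDiff.continuous
    -- continuity, support, integrability
    have hG₁c : Continuous G₁ := (hθc.comp continuous_snd).inner hψ.continuous_timeDeriv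
    have hG₂c : Continuous G₂ :=
      ((hθc.comp continuous_snd).inner (hψ.continuous_convect_slice hθ.contDiff)).add
        ((hconv.comp continuous_snd).inner hψc)
    have hG₁0 : ∀ z ∉ tsupport (uncurry ψ), G₁ z = 0 := fun z hz => by
      simp only [hG₁, timeDeriv_eq_zero_of_notMem_tsupport (t := z.1) (x := z.2) hz,
        inner_zero_right]
    have hG₂0 : ∀ z ∉ tsupport (uncurry ψ), G₂ z = 0 := fun z hz => by
      simp [hG₂, convect_apply, fderiv_slice_eq_zero_of_notMem_tsupport (t := z.1) (x := z.2) hz,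
        apply_eq_zero_of_notMem_tsupport (t := z.1) (x := z.2) hz]
    have hG₁cs : HasCompactSupport G₁ := HasCompactSupport.intro hψ.hasCompactSupport hG₁0
    have hG₂cs : HasCompactSupport G₂ := HasCompactSupport.intro hψ.hasCompactSupport hG₂0
    have hG₁i : Integrable G₁ ((volume : Measure ℝ).prod (volume : Measure E)) := by
      rw [← Measure.volume_eq_prod]; exact hG₁c.integrable_of_hasCompactSupport hG₁cs
    have hG₂i : Integrable G₂ ((volume : Measure ℝ).prod (volume : Measure E)) := by
      rw [← Measure.volume_eq_prod]; exact hG₂c.integrable_of_hasCompactSupport hG₂cs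
    -- `∫∫ G₁ = 0`: integrate first in time
    have hI₁ : ∫ z, G₁ z = 0 := by
      rw [Measure.volume_eq_prod, integral_prod_symm G₁ hG₁i]
      have hx : ∀ x, ∫ t, G₁ (t, x) = 0 := by
        intro x
        have hline : HasCompactSupport fun s => ψ s x := hasCompactSupport_line hψ.hasCompactSupport x
        have hlinec : Continuous fun s => ψ s x := hψc.comp (continuous_id.prodMk continuous_const)
        have hdl : HasCompactSupport fun s => timeDeriv ψ s x := hline.deriv
        have hdlc : Continuous fun s => timeDeriv ψ s x :=
          hψ.continuous_timeDeriv.comp (continuous_id.prodMk continuous_const)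
        have h0 : ∫ t, timeDeriv ψ t x = 0 :=
          integral_eq_zero_of_hasDerivAt_of_integrable (fun s => hψ.hasDerivAt_time s x)
            (hdlc.integrable_of_hasCompactSupport hdl) (hlinec.integrable_of_hasCompactSupport hline)
        simp only [hG₁]
        rw [integral_inner (hdlc.integrable_of_hasCompactSupport hdl), h0, inner_zero_right]
      simp [hx]
    -- `∫∫ G₂ = 0`: slice-wise, `G₂(t, ·) = ⟪θ, ∇⟪θ, ψ t⟫⟫`
    have hI₂ : ∫ z, G₂ z = 0 := by
      rw [Measure.volume_eq_prod, integral_prod G₂ hG₂i]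
      have ht : ∀ t, ∫ x, G₂ (t, x) = 0 := by
        intro t
        set g : E → ℝ := fun x => ⟪θ x, ψ t x⟫ with hg
        have hψt : ContDiff ℝ ∞ (ψ t) := hψ.contDiff_slice t
        have hψtd : Differentiable ℝ (ψ t) := hψt.differentiable (by simp)
        have hgtest : FunctionSpaces.IsTestFunctionOn (⊤ : Opens E) g :=
          ⟨hθ.contDiff.inner ℝ hψt,
            (hψ.hasCompactSupport_slice t).mono fun x hx => by
              contrapose! hx; simp [hg, notMem_support.1 hx],
            by simp⟩
        have hpt : ∀ x, G₂ (t, x) = ⟪θ x, gradient g x⟫ := by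
          intro x
          rw [gradient, ← real_inner_comm, InnerProductSpace.toDual_symm_apply, hg,
            fderiv_inner_apply ℝ (hθd x) (hψtd x) (θ x)]
          simp [hG₂, convect_apply]
        simp_rw [hpt]
        exact hwdf g hgtest
      simp [ht]
    -- assemble
    have hsum : ∀ z, (⟪θ z.2, timeDeriv ψ z.1 z.2⟫ + ⟪θ z.2, convect θ (ψ z.1) z.2⟫ +
        0 * ⟪θ z.2, Δ (ψ z.1) z.2⟫ + (0 : ℝ → E → ℝ) z.1 z.2 * VectorCalculus.divergence (ψ z.1) z.2 +
        ⟪convect θ θ z.2, ψ z.1 z.2⟫) = G₁ z + G₂ z := by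
      intro z; simp only [hG₁, hG₂, Pi.zero_apply, zero_mul, add_zero]; ring
    calc ∫ z in (Q : Set (ℝ × E)), (⟪θ z.2, timeDeriv ψ z.1 z.2⟫ +
          ⟪θ z.2, convect θ (ψ z.1) z.2⟫ + 0 * ⟪θ z.2, Δ (ψ z.1) z.2⟫ +
          (0 : ℝ → E → ℝ) z.1 z.2 * VectorCalculus.divergence (ψ z.1) z.2 + ⟪convect θ θ z.2, ψ z.1 z.2⟫)
        = ∫ z in (Q : Set (ℝ × E)), (G₁ z + G₂ z) := by simp_rw [hsum]
      _ = ∫ z, (G₁ z + G₂ z) := setIntegral_eq_integral_of_forall_compl_eq_zero fun z hz => by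
          rw [hG₁0 z fun h => hz (hψ.tsupport_subset h), hG₂0 z fun h => hz (hψ.tsupport_subset h),
            add_zero]
      _ = (∫ z, G₁ z) + ∫ z, G₂ z := by
          rw [Measure.volume_eq_prod]; exact integral_add hG₁i hG₂i
      _ = 0 := by rw [hI₁, hI₂, add_zero]

end Stationary

/-! ### The counterexample on `ℝ³`: the velocity field `θ = curl (η e₂)` -/

local notation "ℝ³" => EuclideanSpace ℝ (Fin 3)

namespace DistributionalToWeakCounterexample

/-- The unit vector `e₀` of `ℝ³`. [folklore] -/
def e₀ : ℝ³ := EuclideanSpace.single 0 1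

/-- A smooth bump on `ℝ³`: `1` on `B̄(0,1)`, `0` off `B(0,2)`. [folklore] -/
def bump : ContDiffBump (0 : ℝ³) := ⟨1, 2, zero_lt_one, one_lt_two⟩

/-- The scalar profile `η = bump`. [folklore] -/
def η : ℝ³ → ℝ := bump

/-- The potential `Φ = η e₂`. [folklore] -/
def Φ : ℝ³ → ℝ³ := fun x => η x • EuclideanSpace.single 2 1

/-- The velocity `θ = curl (η e₂)`: smooth, compactly supported, divergence free, non-zero. [folklore] -/
def θ : ℝ³ → ℝ³ := curl Φ

/-- `η` is smooth. [folklore] -/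
theorem η_contDiff : ContDiff ℝ ∞ η := bump.contDiff

/-- `η` has compact support. [folklore] -/
theorem η_hasCompactSupport : HasCompactSupport η := bump.hasCompactSupport

/-- `η(0) = 1`. [folklore] -/
theorem η_zero : η 0 = 1 := bump.one_of_mem_closedBall (by simp [bump])

/-- `η(3 e₀) = 0`. [folklore] -/
theorem η_far : η ((3 : ℝ) • e₀) = 0 := by
  refine bump.zero_of_le_dist ?_
  rw [dist_zero_right, norm_smul]
  simp [bump, e₀]
  norm_num

/-- `Φ` is smooth. [folklore] -/
theorem Φ_contDiff : ContDiff ℝ ∞ Φ := η_contDiff.smul contDiff_const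

/-- `Φ` has compact support. [folklore] -/
theorem Φ_hasCompactSupport : HasCompactSupport Φ :=
  η_hasCompactSupport.mono fun x hx => by
    contrapose! hx
    simp [Φ, notMem_support.1 hx]

/-- `θ` is smooth (`VorticityCalculus.contDiff_curl`). [folklore] -/
theorem θ_contDiff : ContDiff ℝ ∞ θ :=
  contDiff_curl (n := ⊤) (Φ_contDiff.of_le (by exact_mod_cast le_top))

/-- `θ` has compact support. [folklore] -/
theorem θ_hasCompactSupport : HasCompactSupport θ := hasCompactSupport_curl Φ_hasCompactSupport

/-- `θ = curl Φ` is divergence free (`divergence_curl_eq_zero_holds`). [folklore] -/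
theorem θ_isDivFree : VectorCalculus.IsDivFree θ := fun x =>
  divergence_curl_eq_zero_holds Φ (contDiff_infty.1 Φ_contDiff 2) x

/-- `θ ∈ C_c^∞(ℝ³; ℝ³)`. [folklore] -/
theorem θ_isTestFunctionOn : FunctionSpaces.IsTestFunctionOn (⊤ : Opens ℝ³) θ :=
  ⟨θ_contDiff, θ_hasCompactSupport, by simp⟩

/-- The second component of `θ = curl (η e₂)` is `-∂₀η`. [folklore] -/
theorem θ_apply_one (x : ℝ³) : θ x 1 = -(fderiv ℝ η x e₀) := by
  have hd : DifferentiableAt ℝ η x := (η_contDiff.differentiable (by simp)) x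
  have hΦ : fderiv ℝ Φ x = (fderiv ℝ η x).smulRight (EuclideanSpace.single 2 1) :=
    fderiv_smul_const hd _
  simp [θ, curl, hΦ, e₀]

/-- `θ` does not vanish identically. [folklore] -/
theorem exists_θ_ne_zero : ∃ x, θ x ≠ 0 := by
  by_contra h
  simp only [not_exists, not_not] at h
  have hD : ∀ y, fderiv ℝ η y e₀ = 0 := fun y => by
    have h1 := θ_apply_one y
    rw [h y] at h1
    simpa using h1
  set g : ℝ → ℝ := fun s => η (s • e₀) with hg
  have hgd : ∀ s, HasDerivAt g 0 s := fun s => by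
    have h1 : HasDerivAt (fun r : ℝ => r • e₀) ((1 : ℝ) • e₀) s := (hasDerivAt_id s).smul_const e₀
    have h2 := ((η_contDiff.differentiable (by simp)) (s • e₀)).hasFDerivAt.comp_hasDerivAt s h1
    rw [one_smul, hD] at h2
    exact h2
  have hconst := is_const_of_deriv_eq_zero (fun s => (hgd s).differentiableAt)
    (fun s => (hgd s).deriv) 0 3
  simp only [hg, zero_smul, η_zero, η_far] at hconst
  exact one_ne_zero hconst


/-! ### The time cut-off and the test field -/

/-- A smooth bump in time: `1` on `[-1/4, 1/4]`, `0` off `(-1/2, 1/2)`. [folklore] -/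
def tbump : ContDiffBump (0 : ℝ) := ⟨1 / 4, 1 / 2, by norm_num, by norm_num⟩

/-- The time profile `χ = tbump`. [folklore] -/
def χ : ℝ → ℝ := tbump

/-- `χ` is smooth. [folklore] -/
theorem χ_contDiff : ContDiff ℝ ∞ χ := tbump.contDiff

/-- `χ` has compact support. [folklore] -/
theorem χ_hasCompactSupport : HasCompactSupport χ := tbump.hasCompactSupport

/-- `χ(0) = 1`. [folklore] -/
theorem χ_zero : χ 0 = 1 := tbump.one_of_mem_closedBall (by simp [tbump])

/-- `χ(1) = 0`. [folklore] -/
theorem χ_one : χ 1 = 0 := tbump.zero_of_le_dist (by simp [tbump]; norm_num)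

/-- `supp χ ⊆ (-∞, 1)` (indeed `= [-1/2, 1/2]`). [folklore] -/
theorem tsupport_χ_subset : tsupport χ ⊆ Iio 1 := by
  rw [show χ = (tbump : ℝ → ℝ) from rfl, tbump.tsupport_eq]
  intro s hs
  simp only [mem_closedBall, dist_zero_right, Real.norm_eq_abs, tbump] at hs
  simp only [mem_Iio]
  linarith [le_abs_self s]

/-- `χ` is differentiable. [folklore] -/
theorem χ_differentiable : Differentiable ℝ χ := χ_contDiff.differentiable (by simp)

/-- The test field `ψ(t, x) = χ(t) θ(x)`. [folklore] -/
def ψ : ℝ → ℝ³ → ℝ³ := fun t x => χ t • θ x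

/-- `ψ` is a space–time test field on the slab `(-∞, 1) × ℝ³`. [folklore] -/
theorem ψ_isSpaceTimeTestOn : IsSpaceTimeTestOn (slab ℝ³ (Iio 1) isOpen_Iio) ψ :=
  isSpaceTimeTestOn_slab_smul isOpen_Iio χ_contDiff χ_hasCompactSupport tsupport_χ_subset
    θ_isTestFunctionOn

/-- Every slice `ψ t = χ(t) θ` is divergence free. [folklore] -/
theorem ψ_isDivFree (t : ℝ) : VectorCalculus.IsDivFree (ψ t) := fun x => by
  show VectorCalculus.divergence (fun y => χ t • θ y) x = 0
  rw [divergence_fun_const_smul ((θ_contDiff.differentiable (by simp)) x), θ_isDivFree x, mul_zero]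

/-! ### The stationary solution, its force, and the hypotheses of the fact -/

/-- The stationary velocity `u(t, x) = θ(x)`. [folklore] -/
def u : ℝ → ℝ³ → ℝ³ := fun _ => θ

/-- The force `f = (θ·∇)θ` generated by the stationary field. [folklore] -/
def f : ℝ → ℝ³ → ℝ³ := fun _ => convect θ θ

/-- `θ` is continuous. [folklore] -/
theorem θ_continuous : Continuous θ := θ_contDiff.continuous

/-- `(θ·∇)θ` is continuous. [folklore] -/
theorem convect_θ_continuous : Continuous (convect θ θ) := by
  have h1 : ContDiff ℝ 1 θ := θ_contDiff.of_le (by exact_mod_cast le_top)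
  show Continuous fun x => fderiv ℝ θ x (θ x)
  exact (h1.continuous_fderiv one_ne_zero).clm_apply θ_continuous

/-- `(u, p) = (θ, 0)` is a distributional solution on the slab `(0, 1) × ℝ³` with `ν = 0` and force
`f = (θ·∇)θ` (`isDistributionalNSSolutionOn_stationary_of_isDivFree`). [folklore] -/
theorem u_isDistributional :
    IsDistributionalNSSolutionOn (slab ℝ³ (Ioo 0 1) isOpen_Ioo) 0 f u 0 :=
  isDistributionalNSSolutionOn_stationary_of_isDivFree θ_isTestFunctionOn θ_isDivFree _

/-- Hypothesis `hu` of the fact: `u = θ` is square integrable on `(0, 1) × K` (it is bounded). [folklore] -/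
theorem u_lintegral_sq_lt_top {K : Set ℝ³} (hK : IsCompact K) :
    ∫⁻ z in Ioo (0 : ℝ) 1 ×ˢ K, ‖uncurry u z‖ₑ ^ 2 < ⊤ := by
  obtain ⟨C, hC⟩ := θ_continuous.bounded_above_of_compact_support θ_hasCompactSupport
  have hle : ∀ z : ℝ × ℝ³, ‖uncurry u z‖ₑ ^ 2 ≤ ENNReal.ofReal C ^ 2 := fun z => by
    gcongr
    rw [← ofReal_norm]
    exact ENNReal.ofReal_le_ofReal (hC z.2)
  calc ∫⁻ z in Ioo (0 : ℝ) 1 ×ˢ K, ‖uncurry u z‖ₑ ^ 2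
      ≤ ∫⁻ _ in Ioo (0 : ℝ) 1 ×ˢ K, ENNReal.ofReal C ^ 2 := lintegral_mono fun z => hle z
    _ = ENNReal.ofReal C ^ 2 * volume (Ioo (0 : ℝ) 1 ×ˢ K) := setLIntegral_const _ _
    _ < ⊤ := ENNReal.mul_lt_top (ENNReal.pow_lt_top ENNReal.ofReal_lt_top)
        (volume_Ioo_prod_lt_top hK)

/-- Hypothesis `hf` of the fact: `f = (θ·∇)θ` is integrable on `(0, 1) × K` (bounded, continuous). [folklore] -/
theorem f_integrableOn {K : Set ℝ³} (hK : IsCompact K) :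
    IntegrableOn (uncurry f) (Ioo (0 : ℝ) 1 ×ˢ K) volume := by
  obtain ⟨C, hC⟩ := convect_θ_continuous.bounded_above_of_compact_support
    (θ_hasCompactSupport.mono fun x hx => by
      contrapose! hx; simp [convect_apply, notMem_support.1 hx])
  exact Measure.integrableOn_of_bounded (M := C) (volume_Ioo_prod_lt_top hK).ne
    ((convect_θ_continuous.comp continuous_snd).aestronglyMeasurable)
    (Eventually.of_forall fun z => hC z.2)

/-! ### The refutation -/

/-- **"Dropping the pressure" is false for a non-measurable datum** (already on `ℝ³`, with
`T = 1`, `ν = 0`, `p = 0`; the negated implication is, written out, the statement of the named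
fact formerly vendored as `IsDistributionalNSSolutionOn.isWeakNSSolutionOn_of` in
`WeakSolution.lean` at these parameters: distributional solution on the slab `(0,1) × ℝ³`, locally
square integrable up to `t = 0`, force integrable on the finite cylinders, datum attained in
`L²_loc` in the sense of lower integrals `⟹` weak solution with that datum). Take the stationary
distributional Euler solution `u(t) = θ = curl (η e₂)` (`η` a bump), `f = (θ·∇)θ`, and the datum
`u₀ = θ + 𝟙_A w`, where `w = θ(x₀) ≠ 0` and `A` is a Vitali slab around `x₀`
(`Literature.MeasureTheory.Lebesgue.Vitali.exists_innerNull_not_nullMeasurableSet`: all measurable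
subsets of `A` are null, and `A ∩ {⟪w, θ⟫ ≠ 0}` is not null-measurable). All hypotheses hold — in
particular the datum hypothesis, since `∫⁻_K ‖u(t) - u₀‖ₑ² = ∫⁻_K ‖𝟙_A w‖ₑ² = 0`
(`lintegral_indicator_datum_eq_zero`) — but the conclusion fails for the divergence-free test field
`ψ = χ(t) θ(x)`, `χ(0) = 1`, `supp χ ⊆ (-1/2, 1/2)`: the space–time part of the weak identity is
`∫₀¹ χ' dt · ‖θ‖²_{L²} + 2 ∫₀¹ χ dt · ∫ ⟪(θ·∇)θ, θ⟫ = -‖θ‖²_{L²}` (the trilinear term vanishes,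
`integral_inner_convect_self_eq_zero_holds`), whereas the datum term `∫ ⟪u₀, ψ(0)⟫ = ∫ ⟪θ + 𝟙_A w, θ⟫`
is the Bochner integral of a function which is not a.e.-strongly measurable, i.e. `0` by
Mathlib's convention; `-‖θ‖²_{L²} ≠ 0`. [folklore] -/
theorem not_isWeakNSSolutionOn_of :
    ∃ u₀ : ℝ³ → ℝ³, ¬ (IsDistributionalNSSolutionOn (slab ℝ³ (Ioo 0 1) isOpen_Ioo) 0 f u 0 →
      (∀ K : Set ℝ³, IsCompact K → ∫⁻ z in Ioo (0 : ℝ) 1 ×ˢ K, ‖uncurry u z‖ₑ ^ 2 < ⊤) →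
      (∀ K : Set ℝ³, IsCompact K → IntegrableOn (uncurry f) (Ioo (0 : ℝ) 1 ×ˢ K) volume) →
      (∀ K : Set ℝ³, IsCompact K →
        Tendsto (fun t => ∫⁻ x in K, ‖u t x - u₀ x‖ₑ ^ 2) (𝓝[>] 0) (𝓝 0)) →
      IsWeakNSSolutionOn 1 0 f u₀ u) := by
  -- the point, the vector, the open set
  obtain ⟨x₀, hx₀⟩ := exists_θ_ne_zero
  set w : ℝ³ := θ x₀ with hw
  set U : Set ℝ³ := {x | ⟪w, θ x⟫ ≠ 0} with hU
  have hUo : IsOpen U := isOpen_ne_fun (continuous_const.inner θ_continuous) continuous_const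
  have hx₀U : x₀ ∈ U := by simpa [hU, hw] using hx₀
  obtain ⟨r, hr, hball⟩ := Metric.isOpen_iff.1 hUo x₀ hx₀U
  -- the Vitali slab
  obtain ⟨A, hAnull, hAnm⟩ := Literature.MeasureTheory.Lebesgue.Vitali.exists_innerNull_not_nullMeasurableSet
    (volume : Measure ℝ³) (EuclideanSpace.proj (0 : Fin 3)) (e := EuclideanSpace.single 0 1)
    (by simp) (fun x => by simpa using PiLp.norm_apply_le x 0) (by simp) x₀ hr
  have hAU : ¬ NullMeasurableSet (A ∩ U) volume :=
    hAnm (A ∩ U) (inter_subset_inter_right _ hball) inter_subset_left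
  -- the datum
  set u₀ : ℝ³ → ℝ³ := fun x => θ x + A.indicator (fun _ => w) x with hu₀
  refine ⟨u₀, fun H => ?_⟩
  have h₀ : ∀ K : Set ℝ³, IsCompact K →
      Tendsto (fun t => ∫⁻ x in K, ‖u t x - u₀ x‖ₑ ^ 2) (𝓝[>] 0) (𝓝 0) := by
    intro K hK
    have hzero : (fun t => ∫⁻ x in K, ‖u t x - u₀ x‖ₑ ^ 2) = fun _ => 0 := by
      funext t
      simp only [u, hu₀, sub_add_cancel_left, enorm_neg]
      exact lintegral_indicator_datum_eq_zero hAnull w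
    rw [hzero]
    exact tendsto_const_nhds
  have hweak : IsWeakNSSolutionOn 1 0 f u₀ u :=
    H u_isDistributional (fun K hK => u_lintegral_sq_lt_top hK) (fun K hK => f_integrableOn hK) h₀
  have hid := hweak.2.2.2 ψ ψ_isSpaceTimeTestOn ψ_isDivFree
  -- the `L²` mass of `θ`
  set M : ℝ := ∫ x, ⟪θ x, θ x⟫ with hM
  have hMpos : 0 < M := by
    refine Continuous.integral_pos_of_hasCompactSupport_nonneg_nonzero (x := x₀)
      (θ_continuous.inner θ_continuous)
      (θ_hasCompactSupport.mono fun x hx => by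
        contrapose! hx; simp [notMem_support.1 hx])
      (fun x => real_inner_self_nonneg) ?_
    exact inner_self_ne_zero.2 hx₀
  -- the space–time part equals `-M`
  have hθd : Differentiable ℝ θ := θ_contDiff.differentiable (by simp)
  have hskew : ∫ x, ⟪convect θ θ x, θ x⟫ = 0 :=
    integral_inner_convect_self_eq_zero_holds θ_isTestFunctionOn θ_isDivFree
  have hslice : ∀ t, ∫ x, (⟪u t x, timeDeriv ψ t x⟫ + ⟪u t x, convect (u t) (ψ t) x⟫ +
      0 * ⟪u t x, Δ (ψ t) x⟫ + ⟪f t x, ψ t x⟫) = deriv χ t * M := by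
    intro t
    have hpt : ∀ x, (⟪u t x, timeDeriv ψ t x⟫ + ⟪u t x, convect (u t) (ψ t) x⟫ +
        0 * ⟪u t x, Δ (ψ t) x⟫ + ⟪f t x, ψ t x⟫) =
        deriv χ t * ⟪θ x, θ x⟫ + 2 * χ t * ⟪convect θ θ x, θ x⟫ := by
      intro x
      have h1 : timeDeriv ψ t x = deriv χ t • θ x := by
        rw [timeDeriv_apply]
        exact deriv_smul_const (χ_differentiable t) (θ x)
      have h2 : convect θ (ψ t) x = χ t • convect θ θ x :=
        convect_fun_const_smul θ (hθd x) (χ t)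
      simp only [u, f, ψ, h1, h2, real_inner_smul_right, zero_mul, add_zero,
        real_inner_comm (θ x) (convect θ θ x)]
      ring
    have hi1 : Integrable (fun x => ⟪θ x, θ x⟫) (volume : Measure ℝ³) :=
      integrable_inner_of_hasCompactSupport_left θ_continuous θ_continuous θ_hasCompactSupport
    have hi2 : Integrable (fun x => ⟪convect θ θ x, θ x⟫) (volume : Measure ℝ³) :=
      integrable_inner_of_hasCompactSupport_right convect_θ_continuous θ_continuous
        θ_hasCompactSupport
    simp_rw [hpt]
    rw [integral_add (hi1.const_mul _) (hi2.const_mul _), integral_const_mul, integral_const_mul,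
      hskew, mul_zero, add_zero]
  have hspace : (∫ t in Ioo (0 : ℝ) 1, ∫ x, (⟪u t x, timeDeriv ψ t x⟫ +
      ⟪u t x, convect (u t) (ψ t) x⟫ + 0 * ⟪u t x, Δ (ψ t) x⟫ + ⟪f t x, ψ t x⟫)) = -M := by
    simp_rw [hslice]
    rw [integral_mul_const, ← integral_Ioc_eq_integral_Ioo,
      ← intervalIntegral.integral_of_le zero_le_one,
      intervalIntegral.integral_deriv_eq_sub (fun s _ => χ_differentiable s)
        ((χ_contDiff.continuous_deriv (by simp)).intervalIntegrable 0 1),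
      χ_one, χ_zero]
    ring
  -- the datum term is the integral of a non-measurable function
  have hψ0 : ∀ x, ψ 0 x = θ x := fun x => by simp [ψ, χ_zero]
  have hnm : ¬ AEStronglyMeasurable (fun x => ⟪u₀ x, ψ 0 x⟫) (volume : Measure ℝ³) := by
    intro hm
    have hm' : AEStronglyMeasurable (fun x => ⟪u₀ x, ψ 0 x⟫ - ⟪θ x, θ x⟫) volume :=
      hm.sub (θ_continuous.inner θ_continuous).aestronglyMeasurable
    have heq : (fun x => ⟪u₀ x, ψ 0 x⟫ - ⟪θ x, θ x⟫) = A.indicator fun x => ⟪w, θ x⟫ := by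
      funext x
      by_cases hx : x ∈ A
      · simp [hu₀, hψ0, hx, inner_add_left]
      · simp [hu₀, hψ0, hx]
    rw [heq] at hm'
    have hs := hm'.nullMeasurableSet_support
    rw [support_indicator] at hs
    exact hAU hs
  have hdatum : ∫ x, ⟪u₀ x, ψ 0 x⟫ = 0 := integral_non_aestronglyMeasurable hnm
  -- contradiction
  rw [hspace, hdatum, add_zero, neg_eq_zero] at hid
  exact hMpos.ne' hid

end DistributionalToWeakCounterexample

/-- **Refutation of the named fact formerly vendored as
`Literature.Analysis.FluidPDE.IsDistributionalNSSolutionOn.isWeakNSSolutionOn_of` in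
`Literature/Analysis/FluidPDE/WeakSolution.lean`** ("dropping the pressure", cited there to
Caffarelli–Kohn–Nirenberg 1982, §2; retired from that file in the 2026-08-15 verdict clean-up,
whence its statement is written out here verbatim at `E = ℝ³`, hypotheses in the original order
`h`, `hu`, `hf`, `h₀`): it is not valid for all data — on `E = ℝ³` there are `T, ν, f, u, u₀, p`
satisfying all its hypotheses but not its conclusion
(`DistributionalToWeakCounterexample.not_isWeakNSSolutionOn_of`), because the datum `u₀` is
constrained only through lower Lebesgue integrals while the conclusion pairs it in a Bochner
integral. The faithful repair — the additional hypothesis `AEStronglyMeasurable u₀ volume`,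
implicit in every printed source, where the datum is an `L²_loc` field (Robinson–Rodrigo–Sadowski
2016, Def. 3.3: `u₀ ∈ H`) — is the proved fact
`IsDistributionalNSSolutionOn.isWeakNSSolutionOn_of_aestronglyMeasurable`
(`Literature/Analysis/FluidPDE/DistributionalToWeak.lean`). [folklore] -/
theorem IsDistributionalNSSolutionOn.not_forall_isWeakNSSolutionOn_of :
    ¬ ∀ (T ν : ℝ) (f u : ℝ → ℝ³ → ℝ³) (u₀ : ℝ³ → ℝ³) (p : ℝ → ℝ³ → ℝ),
      IsDistributionalNSSolutionOn (slab ℝ³ (Ioo 0 T) isOpen_Ioo) ν f u p →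
      (∀ K : Set ℝ³, IsCompact K → ∫⁻ z in Ioo 0 T ×ˢ K, ‖uncurry u z‖ₑ ^ 2 < ⊤) →
      (∀ K : Set ℝ³, IsCompact K → IntegrableOn (uncurry f) (Ioo 0 T ×ˢ K) volume) →
      (∀ K : Set ℝ³, IsCompact K →
        Tendsto (fun t => ∫⁻ x in K, ‖u t x - u₀ x‖ₑ ^ 2) (𝓝[>] 0) (𝓝 0)) →
      IsWeakNSSolutionOn T ν f u₀ u := by
  intro H
  obtain ⟨u₀, hu₀⟩ := DistributionalToWeakCounterexample.not_isWeakNSSolutionOn_of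
  exact hu₀ (H 1 0 _ _ u₀ 0)

end Literature.Analysis.FluidPDE
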